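import Mathlib
import Literature.NumberTheory.Sieve.Maynard2016L1Density
import HarnessLib

/-!
# Maynard 2016, Lemma 8: the section condition of `L1DensityBdd` is automatic (Tonelli, proved)

Topic `Literature/NumberTheory/Sieve`. J. Maynard, *Large gaps between primes*, Ann. of Math. (2)
183 (2016), 915–933 = arXiv:1408.5110, §8, proof of Lemma 8 (approximation step).

`L1DensityBdd` (`Maynard2016L1Density`) asks for an `L¹` bound on the orthant `{t ≥ 0}` AND on each
family of sections `∫_{O_i} ∫_{u>0} |P − G|(t; t_i := u) du dt`, `O_i = {t_i ∈ [0,1], t_ℓ ≥ 0}`.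
By Tonelli the section integrals EQUAL the orthant integral:

* `setIntegral_outer_section_eq` : for an integrable `h` on `ℝ^{n+1}`,
  `∫_{O_i} ∫_{u>0} h(t; t_i := u) du dt = ∫_{s ≥ 0} h(s) ds`

(the measurable equivalence `ℝ^{n+1} ≃ ℝ × ℝ^n`, `t ↦ (t_i, (t_{i.succAbove j})_j)`
(`MeasurableEquiv.piFinSuccAbove`, volume preserving), `(t; t_i := u) = insertNth i u (removeNth i t)`,
`Measure.prod_restrict`, `integral_prod_symm`, `integral_fun_snd`, and `vol [0,1] = 1`).
Hence the residual analytic input of Lemma 8 in its final, single-condition form: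

* `L1DensityOrth` — for `k ≥ 1`, measurable `F : ℝ^k → [0,1]` supported in `R_k`, and `δ > 0`,
  there are `J`, `c_j > 0` and bump data `(w, φ)` (`IsBumpData`) with `P = Σ_j c_j ∏_ℓ φ_{ℓ,j}(t_ℓ) ≤ 1`
  on the orthant and `∫_{t ≥ 0} |P(t) − F(10t)| dt ≤ δ`. Named fact, not proved here
  (pure measure theory: grid histograms + `cellBump` smoothing; see `Maynard2016L1Density`);

and `l1DensityBdd_of_orth : L1DensityOrth → L1DensityBdd` (PROVED), so
`theorem1_of_lemma7_l1DensityOrth : Lemma7 → L1DensityOrth → Maynard2016_theorem1`.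

## References

* J. Maynard, *Large gaps between primes*, Ann. of Math. (2) 183 (2016), 915–933; arXiv:1408.5110,
  Lemma 8 (proof, approximation step). [Maynard2016LargeGaps]
-/

open Filter Finset MeasureTheory Set
open scoped Topology ContDiff

namespace Literature.NumberTheory.Sieve

namespace Maynard2016

/-! ### The coordinate splitting `ℝ^{n+1} ≃ ℝ × ℝ^n` at `i` -/

/-- `t ↦ (t_i, (t_{i.succAbove j})_j)` as a measurable equivalence. [cite: Maynard2016LargeGaps, Lemma 8 (proof)] -/
noncomputable def secEquiv {n : ℕ} (i : Fin (n + 1)) : (Fin (n + 1) → ℝ) ≃ᵐ ℝ × (Fin n → ℝ) :=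
  MeasurableEquiv.piFinSuccAbove (fun _ : Fin (n + 1) => ℝ) i

/-- `(secEquiv i)⁻¹ (u, t') = insertNth i u t'`. [cite: Maynard2016LargeGaps, Lemma 8 (proof)] -/
theorem secEquiv_symm_apply {n : ℕ} (i : Fin (n + 1)) (p : ℝ × (Fin n → ℝ)) :
    (secEquiv i).symm p = Fin.insertNth i p.1 p.2 := rfl

/-- `(secEquiv i t).1 = t_i`. [cite: Maynard2016LargeGaps, Lemma 8 (proof)] -/
theorem secEquiv_apply_fst {n : ℕ} (i : Fin (n + 1)) (t : Fin (n + 1) → ℝ) :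
    (secEquiv i t).1 = t i := rfl

/-- `(secEquiv i t).2 = removeNth i t`. [cite: Maynard2016LargeGaps, Lemma 8 (proof)] -/
theorem secEquiv_apply_snd {n : ℕ} (i : Fin (n + 1)) (t : Fin (n + 1) → ℝ) :
    (secEquiv i t).2 = Fin.removeNth i t := rfl

/-- `secEquiv i` preserves Lebesgue measure. [cite: Maynard2016LargeGaps, Lemma 8 (proof)] -/
theorem measurePreserving_secEquiv {n : ℕ} (i : Fin (n + 1)) :
    MeasurePreserving (secEquiv i) volume volume :=
  volume_preserving_piFinSuccAbove (fun _ : Fin (n + 1) => ℝ) i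

/-- `(t; t_i := u) = (secEquiv i)⁻¹ (u, (secEquiv i t).2)`. [cite: Maynard2016LargeGaps, Lemma 8 (proof)] -/
theorem update_eq_secEquiv_symm {n : ℕ} (i : Fin (n + 1)) (t : Fin (n + 1) → ℝ) (u : ℝ) :
    Function.update t i u = (secEquiv i).symm (u, (secEquiv i t).2) := by
  have h1 : secEquiv i (Function.update t i u) = (u, (secEquiv i t).2) := by
    refine Prod.ext ?_ ?_
    · rw [secEquiv_apply_fst, Function.update_self]
    · rw [secEquiv_apply_snd, secEquiv_apply_snd, Fin.removeNth_update]
  rw [← h1, MeasurableEquiv.symm_apply_apply]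

/-- Preimage of the orthant under `(secEquiv i)⁻¹`: `[0,∞) × (orthant of ℝ^n)`. [cite: Maynard2016LargeGaps, Lemma 8 (proof)] -/
theorem secEquiv_symm_preimage_orthant {n : ℕ} (i : Fin (n + 1)) :
    (secEquiv i).symm ⁻¹' (Set.univ.pi fun _ : Fin (n + 1) => Set.Ici (0 : ℝ)) =
      Set.Ici (0 : ℝ) ×ˢ (Set.univ.pi fun _ : Fin n => Set.Ici (0 : ℝ)) := by
  ext p
  simp only [Set.mem_preimage, Set.mem_univ_pi, Set.mem_Ici, Set.mem_prod, secEquiv_symm_apply]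
  rw [Fin.forall_iff_succAbove i]
  simp only [Fin.insertNth_apply_same, Fin.insertNth_apply_succAbove]

/-- Preimage of `[0,1] × (orthant of ℝ^n)` under `secEquiv i`: the outer set `O_i`. [cite: Maynard2016LargeGaps, Lemma 8 (proof)] -/
theorem secEquiv_preimage_prod {n : ℕ} (i : Fin (n + 1)) :
    (secEquiv i) ⁻¹' (Set.Icc (0 : ℝ) 1 ×ˢ (Set.univ.pi fun _ : Fin n => Set.Ici (0 : ℝ))) =
      Set.univ.pi (fun ℓ : Fin (n + 1) => if ℓ = i then Set.Icc (0 : ℝ) 1 else Set.Ici 0) := by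
  ext t
  simp only [Set.mem_preimage, Set.mem_prod, Set.mem_univ_pi]
  rw [Fin.forall_iff_succAbove i, if_pos rfl]
  refine and_congr Iff.rfl (forall_congr' fun j => ?_)
  rw [if_neg (Fin.succAbove_ne i j)]
  rfl

/-! ### Tonelli for the sections -/

/-- **`∫_{O_i} ∫_{u>0} h(t; t_i := u) du dt = ∫_{s ≥ 0} h(s) ds`** for integrable `h` on `ℝ^{n+1}`
(`O_i = {t_i ∈ [0,1], t_ℓ ≥ 0 (ℓ ≠ i)}`). [cite: Maynard2016LargeGaps, Lemma 8 (proof)] -/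
theorem setIntegral_outer_section_eq {n : ℕ} (i : Fin (n + 1)) (h : (Fin (n + 1) → ℝ) → ℝ)
    (hint : Integrable h) :
    ∫ t in Set.univ.pi (fun ℓ : Fin (n + 1) => if ℓ = i then Set.Icc (0 : ℝ) 1 else Set.Ici 0),
        ∫ u in Set.Ioi (0 : ℝ), h (Function.update t i u) =
      ∫ s in Set.univ.pi (fun _ : Fin (n + 1) => Set.Ici (0 : ℝ)), h s := by
  set e := secEquiv i with he_def
  have he : MeasurePreserving e volume volume := measurePreserving_secEquiv i
  set orthn := Set.univ.pi fun _ : Fin n => Set.Ici (0 : ℝ) with horthn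
  -- the section functional in the split coordinates
  set Ψ : (Fin n → ℝ) → ℝ := fun t' => ∫ u in Set.Ioi (0 : ℝ), h (e.symm (u, t')) with hΨ
  -- LHS
  have hL : ∫ t in Set.univ.pi (fun ℓ : Fin (n + 1) => if ℓ = i then Set.Icc (0 : ℝ) 1
      else Set.Ici 0), ∫ u in Set.Ioi (0 : ℝ), h (Function.update t i u) = ∫ t' in orthn, Ψ t' := by
    have h1 : (fun t : Fin (n + 1) → ℝ => ∫ u in Set.Ioi (0 : ℝ), h (Function.update t i u)) =
        fun t => (Ψ ∘ Prod.snd) (e t) := by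
      funext t
      simp only [Function.comp, hΨ]
      refine integral_congr_ae (Eventually.of_forall fun u => ?_)
      show h (Function.update t i u) = h (e.symm (u, (e t).2))
      rw [update_eq_secEquiv_symm]
    rw [← secEquiv_preimage_prod i, h1, he.setIntegral_preimage_emb e.measurableEmbedding]
    show ∫ p in Set.Icc (0 : ℝ) 1 ×ˢ orthn, Ψ p.2 ∂(volume.prod volume) = ∫ t' in orthn, Ψ t'
    rw [← Measure.prod_restrict, integral_fun_snd, measureReal_restrict_apply_univ,
      Real.volume_real_Icc_of_le zero_le_one, sub_zero, one_smul]
  -- RHS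
  have hR : ∫ s in Set.univ.pi (fun _ : Fin (n + 1) => Set.Ici (0 : ℝ)), h s =
      ∫ t' in orthn, Ψ t' := by
    have hes : MeasurePreserving e.symm volume volume := he.symm e
    rw [← hes.setIntegral_preimage_emb e.symm.measurableEmbedding h, he_def,
      secEquiv_symm_preimage_orthant i, ← he_def]
    show ∫ p in Set.Ici (0 : ℝ) ×ˢ orthn, h (e.symm p) ∂(volume.prod volume) = ∫ t' in orthn, Ψ t'
    have hio : IntegrableOn (fun p => h (e.symm p)) (Set.Ici (0 : ℝ) ×ˢ orthn)
        ((volume : Measure ℝ).prod (volume : Measure (Fin n → ℝ))) := by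
      have := (hes.integrableOn_comp_preimage e.symm.measurableEmbedding (f := h)
        (s := Set.univ.pi fun _ : Fin (n + 1) => Set.Ici (0 : ℝ))).2 hint.integrableOn
      rw [he_def, secEquiv_symm_preimage_orthant i, ← he_def] at this
      exact this
    rw [IntegrableOn, ← Measure.prod_restrict] at hio
    rw [← Measure.prod_restrict, integral_prod_symm _ hio]
    refine integral_congr_ae (Eventually.of_forall fun t' => ?_)
    show ∫ u in Set.Ici (0 : ℝ), h (e.symm (u, t')) = Ψ t'
    simp only [hΨ]
    exact setIntegral_congr_set Ioi_ae_eq_Ici.symm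
  rw [hL, hR]

/-! ### The single-condition form of the residual input -/

/-- **Maynard 2016, Lemma 8, approximation step — final form** (pure `L¹` density on the orthant):
for `k ≥ 1`, a measurable `F : ℝ^k → [0,1]` supported in `R_k`, and `δ > 0`, there are `J`, `c_j > 0`
and bump data `(w, φ)` (`IsBumpData`) with `Σ_j c_j ∏_ℓ φ_{ℓ,j}(t_ℓ) ≤ 1` for `t ≥ 0` and
`∫_{t ≥ 0} |Σ_j c_j ∏_ℓ φ_{ℓ,j}(t_ℓ) − F(10t)| dt ≤ δ`. Named fact, not proved here. [cite: Maynard2016LargeGaps, Lemma 8 (proof, "such functions are dense")] -/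
def L1DensityOrth : Prop :=
  ∀ k : ℕ, 1 ≤ k → ∀ F : (Fin k → ℝ) → ℝ, Measurable F → Function.support F ⊆ maynardSimplex k →
    (∀ t, 0 ≤ F t ∧ F t ≤ 1) → ∀ δ : ℝ, 0 < δ →
      ∃ (J : ℕ) (c : Fin J → ℝ) (w : Fin k → Fin J → ℝ) (φ : Fin k → Fin J → ℝ → ℝ),
        (∀ j, 0 < c j) ∧ IsBumpData k J w φ ∧
          (∀ t : Fin k → ℝ, (∀ ℓ, 0 ≤ t ℓ) → bumpSum c φ t ≤ 1) ∧
          ∫ t in Set.univ.pi (fun _ : Fin k => Set.Ici (0 : ℝ)),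
              |bumpSum c φ t - F ((10 : ℝ) • t)| ≤ δ

/-- **`L1DensityBdd` from the orthant-only form, PROVED** (`setIntegral_outer_section_eq` applied to
`1_{t ≥ 0} |P − G|`, which is integrable: bounded, measurable, vanishing off `[0,1/10]^k`).
[cite: Maynard2016LargeGaps, Lemma 8 (proof, approximation step)] -/
theorem l1DensityBdd_of_orth (hL : L1DensityOrth) : L1DensityBdd := by
  intro k hk F hFm hFs hF01 δ hδ
  obtain ⟨J, c, w, φ, hc, hφ, hP1, hI⟩ := hL k hk F hFm hFs hF01 δ hδ
  refine ⟨J, c, w, φ, hc, hφ, hP1, hI, ?_⟩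
  obtain ⟨n, rfl⟩ : ∃ n, k = n + 1 := ⟨k - 1, by omega⟩
  intro i
  set P := bumpSum c φ with hP
  set orth := Set.univ.pi fun _ : Fin (n + 1) => Set.Ici (0 : ℝ) with horth
  set box := Set.univ.pi fun _ : Fin (n + 1) => Set.Icc (0 : ℝ) (1 / 10) with hbox
  have horthm : MeasurableSet orth := MeasurableSet.univ_pi fun _ => measurableSet_Ici
  have hboxm : MeasurableSet box := MeasurableSet.univ_pi fun _ => measurableSet_Icc
  have hsub : box ⊆ orth := Set.pi_mono fun _ _ => Set.Icc_subset_Ici_self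
  have hPc : Continuous P := continuous_bumpSum c hφ
  have hGm : Measurable fun t : Fin (n + 1) → ℝ => F ((10 : ℝ) • t) :=
    hFm.comp (measurable_const_smul (10 : ℝ))
  -- the integrand, extended by zero outside the orthant
  set g : (Fin (n + 1) → ℝ) → ℝ := orth.indicator fun s => |P s - F ((10 : ℝ) • s)| with hg
  have hzero : ∀ t ∈ orth \ box, P t = 0 ∧ F ((10 : ℝ) • t) = 0 := by
    intro t ht
    obtain ⟨hto, htb⟩ := ht
    have : ∃ ℓ, 1 / 10 < t ℓ := by
      by_contra hcon
      refine htb (Set.mem_univ_pi.2 fun ℓ => ⟨Set.mem_Ici.1 (Set.mem_univ_pi.1 hto ℓ), ?_⟩)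
      exact not_lt.1 fun hlt => hcon ⟨ℓ, hlt⟩
    obtain ⟨ℓ, hℓ⟩ := this
    exact ⟨bumpSum_eq_zero_of_lt c hφ hℓ, scaled_eq_zero_of_lt hFs hℓ⟩
  have hgi : Integrable g := by
    rw [hg, integrable_indicator_iff horthm]
    refine IntegrableOn.of_forall_sdiff_eq_zero ?_ horthm (fun t ht => by
      rw [(hzero t ht).1, (hzero t ht).2, sub_zero, abs_zero])
    refine integrableOn_of_abs_le hboxm (volume_tenthBox_ne_top (n + 1))
      ((hPc.measurable.sub hGm).abs) (M := 1) fun t ht => ?_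
    have h0 := bumpSum_nonneg hφ hc t
    have h1 := hP1 t fun ℓ => (Set.mem_univ_pi.1 ht ℓ).1
    have h2 := (hF01 ((10 : ℝ) • t)).1
    have h3 := (hF01 ((10 : ℝ) • t)).2
    rw [abs_abs, abs_le]
    constructor <;> linarith
  have hT := setIntegral_outer_section_eq i g hgi
  -- identify both sides
  have hlhs : ∫ t in Set.univ.pi (fun ℓ : Fin (n + 1) => if ℓ = i then Set.Icc (0 : ℝ) 1
      else Set.Ici 0), ∫ u in Set.Ioi (0 : ℝ),
        |P (Function.update t i u) - F ((10 : ℝ) • Function.update t i u)| =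
      ∫ t in Set.univ.pi (fun ℓ : Fin (n + 1) => if ℓ = i then Set.Icc (0 : ℝ) 1 else Set.Ici 0),
        ∫ u in Set.Ioi (0 : ℝ), g (Function.update t i u) := by
    refine setIntegral_congr_fun (measurableSet_outer i) fun t ht => ?_
    refine setIntegral_congr_fun measurableSet_Ioi fun u hu => ?_
    have hmem : Function.update t i u ∈ orth := by
      refine Set.mem_univ_pi.2 fun ℓ => Set.mem_Ici.2 ?_
      by_cases hℓ : ℓ = i
      · subst hℓ; rw [Function.update_self]; exact le_of_lt hu
      · rw [Function.update_of_ne hℓ]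
        have := Set.mem_univ_pi.1 ht ℓ
        rw [if_neg hℓ] at this
        exact this
    simp only [hg]
    rw [Set.indicator_of_mem hmem]
  have hrhs : ∫ s in orth, g s = ∫ s in orth, |P s - F ((10 : ℝ) • s)| :=
    setIntegral_congr_fun horthm fun s hs => by simp only [hg]; rw [Set.indicator_of_mem hs]
  rw [hlhs, hT, hrhs]
  exact hI

/-- `ScaledDensityBdd` from the orthant-only form. [cite: Maynard2016LargeGaps, Lemma 8 (proof)] -/
theorem scaledDensityBdd_of_l1DensityOrth (hL : L1DensityOrth) : ScaledDensityBdd :=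
  scaledDensityBdd_of_l1DensityBdd (l1DensityBdd_of_orth hL)

/-- `Lemma8` from the orthant-only form. [cite: Maynard2016LargeGaps, Lemma 8] -/
theorem lemma8_of_l1DensityOrth (hL : L1DensityOrth) : Lemma8 :=
  lemma8_of_l1DensityBdd (l1DensityBdd_of_orth hL)

/-- **Maynard's Theorem 1 from `Lemma7` and `L1DensityOrth`.** [cite: Maynard2016LargeGaps, Theorem 1] -/
theorem theorem1_of_lemma7_l1DensityOrth (h7 : Lemma7) (hL : L1DensityOrth) :
    Literature.NumberTheory.Sieve.Maynard2016_theorem1 :=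
  theorem1_of_lemma7_l1DensityBdd h7 (l1DensityBdd_of_orth hL)

/-- **`∀ c, RankinConstant c` from `Lemma7` and `L1DensityOrth`.** [cite: Maynard2016LargeGaps, Theorem 1] -/
theorem forall_rankinConstant_of_lemma7_l1DensityOrth (h7 : Lemma7) (hL : L1DensityOrth) (c : ℝ) :
    Literature.NumberTheory.Sieve.RankinConstant c :=
  forall_rankinConstant_of_lemma7_l1DensityBdd h7 (l1DensityBdd_of_orth hL) c

end Maynard2016

end Literature.NumberTheory.Sieve
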